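import Summits.AtomisticToContinuum.HydrodynamicLimit.Theorems.JParityClosureParityBandClosureStressIsotropyOfWindowCovarianceH
import Summits.AtomisticToContinuum.HydrodynamicLimit.Theorems.JParityClosureParityBandClosureStressIsotropyOfWindowCovarianceD
import HarnessLib

/-!
# Window-to-cone step of `ParityBandClosure` — helper I: Tonelli over the windows

Support file for the stub `stub_stressIsotropyOfWindowCovariance` of the line `transfer-weighted-parity-chain`
(skeleton v4) of the crux `JParityClosure.ParityBandClosure` (stmt-AtomisticToContinuum-17608).  The majorants of the
one-window estimate (helper G) are integrated over all windows `(t₀, x) ∈ I × 𝕋³` (`I ⊆ [r², τ − r²]`, full windows) as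
LEBESGUE integrals, so that only measurability is ever needed.  §1 two generic Tonelli lemmas: a tent-windowed
nonnegative `(s, x)`-field whose space integral at each instant is `≤ q(s)` has `∫⁻_I ∫⁻_x ofReal (∫ w F) ≤ ofReal (∫ q)`
(the windows see each instant with total tent mass `≤ 1`); a tent-windowed nonnegative increment integrand whose space
integral is `≤ b(t₀)` on the window has `∫⁻_I ∫⁻_x ofReal (∫ w H) ≤ ∫⁻_I ofReal b`.  §2 the instances along a hard-sphere
trajectory: the tail terms against `𝒯 = ∫_{[0,τ]} (N+1)⁻¹ Σ sqTail V (vᵢ(s)) ds`, the energy term against `ke · τ`, the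
density increment against `8(½ + ke) r τ` and the momentum increment against `16 ke r τ + (N+1)⁻¹ 8 ε r 𝒮(0, τ]`
(helpers C, D).  References: Tonelli; helpers C, D, F, H of this stub.
-/

noncomputable section

namespace Summit.AtomisticToContinuum.HydrodynamicLimit.Theorems.ParityBandClosureWindowToCone

open scoped BigOperators Topology Classical MeasureTheory ENNReal InnerProductSpace
open Filter Set MeasureTheory Function
open Literature.MathematicalPhysics.KineticTheory
open Literature.Analysis.FluidPDE
open Literature.Analysis.FunctionSpaces
open Summit.AtomisticToContinuum.HydrodynamicLimit.Theorems.LocalSecondLawNegative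
open Summit.AtomisticToContinuum.HydrodynamicLimit.Theorems.LocalSecondLawLedger
open Summit.AtomisticToContinuum.HydrodynamicLimit.Theorems.ChaosClosesEulerReduction
open Summit.AtomisticToContinuum.HydrodynamicLimit.Theorems.ChaosClosesEulerStressIsotropy
open Summit.AtomisticToContinuum.HydrodynamicLimit.Theorems.ChaosClosesEulerWindowedInvariance (tent_nonneg_le cone_nonneg_le)
open Summit.AtomisticToContinuum.HydrodynamicLimit.Theorems.ChaosClosesEulerPressureValue
  (tent_eq_zero_of_le abs_lt_of_tent_ne_zero setIntegral_tent_le_one integrable_tent_sub)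

variable {N : ℕ}

/-! ## §1 Generic Tonelli lemmas for tent-windowed fields -/

/-- The Lebesgue integral of the tent over a full window is one. [folklore] -/
theorem lintegral_tent_eq_one {r : ℝ} (hr : 0 < r) {τ t₀ : ℝ} (h1 : r ^ 2 ≤ t₀) (h2 : t₀ + r ^ 2 ≤ τ) :
    ∫⁻ s in Icc 0 τ, ENNReal.ofReal ((r ^ 2)⁻¹ * max (1 - |s - t₀| / r ^ 2) 0) = 1 := by
  have hh : 0 < r ^ 2 := by positivity
  rw [← ofReal_integral_eq_lintegral_ofReal ((integrable_tent_sub' hh t₀).integrableOn)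
    (ae_of_all _ fun s => (tent_nonneg_le hh _).1), window_mass_eq_one hh (by linarith) h2, ENNReal.ofReal_one]

/-- The Lebesgue integral of the tent over the window CENTRES is at most one. [folklore] -/
theorem lintegral_tent_centre_le_one {r : ℝ} (hr : 0 < r) (s : ℝ) (I : Set ℝ) :
    ∫⁻ t₀ in I, ENNReal.ofReal ((r ^ 2)⁻¹ * max (1 - |s - t₀| / r ^ 2) 0) ≤ 1 := by
  have hh : 0 < r ^ 2 := by positivity
  rw [← ofReal_integral_eq_lintegral_ofReal ((integrable_tent_sub hh s).integrableOn)
    (ae_of_all _ fun t₀ => (tent_nonneg_le hh _).1), ← ENNReal.ofReal_one]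
  exact ENNReal.ofReal_le_ofReal (setIntegral_tent_le_one hh s I)

/-- The space integral of a bounded nonnegative measurable `(s, x)`-field at one instant, as a Lebesgue integral.
[folklore] -/
theorem lintegral_space_eq_ofReal {F : ℝ × T3 → ℝ} (hF : Measurable F) (h0 : ∀ p, 0 ≤ F p) {B : ℝ} (hB : ∀ p, F p ≤ B)
    (s : ℝ) : ∫⁻ x, ENNReal.ofReal (F (s, x)) = ENNReal.ofReal (∫ x, F (s, x)) := by
  have hm : Measurable fun x : T3 => F (s, x) := (Measurable.comp hF (measurable_const.prodMk measurable_id) :)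
  have h1 : IntegrableOn (fun x : T3 => F (s, x)) Set.univ volume :=
    Measure.integrableOn_of_bounded (M := B) (measure_ne_top _ _) hm.aestronglyMeasurable
      (ae_of_all _ fun x => by rw [Real.norm_eq_abs, abs_of_nonneg (h0 _)]; exact hB _)
  rw [integrableOn_univ] at h1
  exact (ofReal_integral_eq_lintegral_ofReal h1 (ae_of_all _ fun x => h0 _)).symm

/-- **Tonelli for a tent-windowed field.**  Let `F ≥ 0` be a bounded measurable `(s, x)`-field with
`∫ₓ F(s, ·) ≤ q(s)` for `s ∈ [0, τ]`, `q ≥ 0` measurable and integrable on `[0, τ]`.  Then for every `I`,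
`∫⁻_{t₀ ∈ I} ∫⁻_x ofReal (∫_{s ∈ [0,τ]} w(s − t₀) F(s, x) ds) ≤ ofReal (∫_{[0,τ]} q)`. [folklore] -/
theorem lintegral_window_field_le {r : ℝ} (hr : 0 < r) (τ : ℝ) {F : ℝ × T3 → ℝ} (hF : Measurable F) (h0 : ∀ p, 0 ≤ F p)
    {B : ℝ} (hB : ∀ p, F p ≤ B) {q : ℝ → ℝ} (hqm : Measurable q) (hq0 : ∀ s, 0 ≤ q s)
    (hqi : IntegrableOn q (Icc 0 τ) volume) (hFq : ∀ s ∈ Icc 0 τ, ∫ x, F (s, x) ≤ q s) (I : Set ℝ) :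
    ∫⁻ t₀ in I, ∫⁻ x, ENNReal.ofReal (∫ s in Icc 0 τ, (r ^ 2)⁻¹ * max (1 - |s - t₀| / r ^ 2) 0 * F (s, x)) ≤
      ENNReal.ofReal (∫ s in Icc 0 τ, q s) := by
  have hh : 0 < r ^ 2 := by positivity
  have hw0 : ∀ a, 0 ≤ (r ^ 2)⁻¹ * max (1 - |a| / r ^ 2) 0 := fun a => (tent_nonneg_le hh a).1
  -- step 1: the `s`-integral as a Lebesgue integral, pointwise in `(t₀, x)`
  have hstep1 : ∀ t₀ x, ENNReal.ofReal (∫ s in Icc 0 τ, (r ^ 2)⁻¹ * max (1 - |s - t₀| / r ^ 2) 0 * F (s, x)) =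
      ∫⁻ s in Icc 0 τ, ENNReal.ofReal ((r ^ 2)⁻¹ * max (1 - |s - t₀| / r ^ 2) 0 * F (s, x)) := by
    intro t₀ x
    have hmx : Measurable fun s => F (s, x) := (Measurable.comp hF (measurable_id.prodMk measurable_const) :)
    refine ofReal_integral_eq_lintegral_ofReal (integrableOn_tent_mul hr t₀ τ hmx (B := B) fun s => ?_)
      (ae_of_all _ fun s => mul_nonneg (hw0 _) (h0 _))
    rw [abs_of_nonneg (h0 _)]; exact hB _
  -- step 2: per centre, swap `x` and `s`
  have hstep2 : ∀ t₀, ∫⁻ x, ∫⁻ s in Icc 0 τ, ENNReal.ofReal ((r ^ 2)⁻¹ * max (1 - |s - t₀| / r ^ 2) 0 * F (s, x)) ≤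
      ∫⁻ s in Icc 0 τ, ENNReal.ofReal ((r ^ 2)⁻¹ * max (1 - |s - t₀| / r ^ 2) 0) * ENNReal.ofReal (q s) := by
    intro t₀
    have hm2 : Measurable fun p : T3 × ℝ => ENNReal.ofReal ((r ^ 2)⁻¹ * max (1 - |p.2 - t₀| / r ^ 2) 0 * F (p.2, p.1)) := by
      have ha : Measurable fun p : T3 × ℝ => (r ^ 2)⁻¹ * max (1 - |p.2 - t₀| / r ^ 2) 0 :=
        measurable_const.mul ((measurable_const.sub (((measurable_snd.sub measurable_const).abs).div_const _)).max
          measurable_const)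
      have hb : Measurable fun p : T3 × ℝ => F (p.2, p.1) := (Measurable.comp hF (measurable_snd.prodMk measurable_fst) :)
      exact (ha.mul hb).ennreal_ofReal
    rw [lintegral_lintegral_swap hm2.aemeasurable]
    refine setLIntegral_mono' measurableSet_Icc fun s hs => ?_
    have hmx : Measurable fun x : T3 => ENNReal.ofReal (F (s, x)) :=
      ((Measurable.comp hF (measurable_const.prodMk measurable_id) :)).ennreal_ofReal
    calc ∫⁻ x, ENNReal.ofReal ((r ^ 2)⁻¹ * max (1 - |s - t₀| / r ^ 2) 0 * F (s, x))
        = ∫⁻ x, ENNReal.ofReal ((r ^ 2)⁻¹ * max (1 - |s - t₀| / r ^ 2) 0) * ENNReal.ofReal (F (s, x)) :=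
          lintegral_congr fun x => ENNReal.ofReal_mul (hw0 _)
      _ = ENNReal.ofReal ((r ^ 2)⁻¹ * max (1 - |s - t₀| / r ^ 2) 0) * ∫⁻ x, ENNReal.ofReal (F (s, x)) :=
          lintegral_const_mul _ hmx
      _ ≤ ENNReal.ofReal ((r ^ 2)⁻¹ * max (1 - |s - t₀| / r ^ 2) 0) * ENNReal.ofReal (q s) := by
          rw [lintegral_space_eq_ofReal hF h0 hB s]
          exact mul_le_mul_right (ENNReal.ofReal_le_ofReal (hFq s hs)) _
  -- step 3: swap the centre and the instant; the centres see each instant with total tent mass `≤ 1`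
  have hm3 : Measurable fun p : ℝ × ℝ => ENNReal.ofReal ((r ^ 2)⁻¹ * max (1 - |p.2 - p.1| / r ^ 2) 0) * ENNReal.ofReal (q p.2) := by
    have ha : Measurable fun p : ℝ × ℝ => (r ^ 2)⁻¹ * max (1 - |p.2 - p.1| / r ^ 2) 0 := by fun_prop
    exact ha.ennreal_ofReal.mul ((hqm.comp measurable_snd).ennreal_ofReal)
  calc ∫⁻ t₀ in I, ∫⁻ x, ENNReal.ofReal (∫ s in Icc 0 τ, (r ^ 2)⁻¹ * max (1 - |s - t₀| / r ^ 2) 0 * F (s, x))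
      = ∫⁻ t₀ in I, ∫⁻ x, ∫⁻ s in Icc 0 τ, ENNReal.ofReal ((r ^ 2)⁻¹ * max (1 - |s - t₀| / r ^ 2) 0 * F (s, x)) := by
        simp_rw [hstep1]
    _ ≤ ∫⁻ t₀ in I, ∫⁻ s in Icc 0 τ, ENNReal.ofReal ((r ^ 2)⁻¹ * max (1 - |s - t₀| / r ^ 2) 0) * ENNReal.ofReal (q s) :=
        lintegral_mono fun t₀ => hstep2 t₀
    _ = ∫⁻ s in Icc 0 τ, ∫⁻ t₀ in I, ENNReal.ofReal ((r ^ 2)⁻¹ * max (1 - |s - t₀| / r ^ 2) 0) * ENNReal.ofReal (q s) :=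
        lintegral_lintegral_swap hm3.aemeasurable
    _ = ∫⁻ s in Icc 0 τ, (∫⁻ t₀ in I, ENNReal.ofReal ((r ^ 2)⁻¹ * max (1 - |s - t₀| / r ^ 2) 0)) * ENNReal.ofReal (q s) := by
        refine lintegral_congr fun s => ?_
        exact lintegral_mul_const _ ((by fun_prop : Measurable fun t₀ : ℝ => (r ^ 2)⁻¹ * max (1 - |s - t₀| / r ^ 2) 0).ennreal_ofReal)
    _ ≤ ∫⁻ s in Icc 0 τ, 1 * ENNReal.ofReal (q s) :=
        lintegral_mono fun s => mul_le_mul_left (lintegral_tent_centre_le_one hr s I) _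
    _ = ENNReal.ofReal (∫ s in Icc 0 τ, q s) := by
        simp_rw [one_mul]
        exact (ofReal_integral_eq_lintegral_ofReal hqi (ae_of_all _ fun s => hq0 s)).symm

/-- **Tonelli for an instantaneous field over the windows**: for a bounded measurable `F ≥ 0` with
`∫ₓ F(s, ·) ≤ q(s)` on `[0, τ]` (`q ≥ 0` measurable, integrable on `[0, τ]`) and `I ⊆ [0, τ]`:
`∫⁻_{t₀ ∈ I} ∫⁻_x ofReal (F(t₀, x)) ≤ ofReal (∫_{[0,τ]} q)`. [folklore] -/
theorem lintegral_instant_field_le (τ : ℝ) {F : ℝ × T3 → ℝ} (hF : Measurable F) (h0 : ∀ p, 0 ≤ F p) {B : ℝ}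
    (hB : ∀ p, F p ≤ B) {q : ℝ → ℝ} (hq0 : ∀ s, 0 ≤ q s) (hqi : IntegrableOn q (Icc 0 τ) volume)
    (hFq : ∀ s ∈ Icc 0 τ, ∫ x, F (s, x) ≤ q s) {I : Set ℝ} (hI : I ⊆ Icc 0 τ) :
    ∫⁻ t₀ in I, ∫⁻ x, ENNReal.ofReal (F (t₀, x)) ≤ ENNReal.ofReal (∫ s in Icc 0 τ, q s) := by
  calc ∫⁻ t₀ in I, ∫⁻ x, ENNReal.ofReal (F (t₀, x)) ≤ ∫⁻ t₀ in Icc 0 τ, ∫⁻ x, ENNReal.ofReal (F (t₀, x)) :=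
        lintegral_mono_set hI
    _ ≤ ∫⁻ t₀ in Icc 0 τ, ENNReal.ofReal (q t₀) := by
        refine setLIntegral_mono' measurableSet_Icc fun t₀ ht₀ => ?_
        rw [lintegral_space_eq_ofReal hF h0 hB t₀]
        exact ENNReal.ofReal_le_ofReal (hFq t₀ ht₀)
    _ = ENNReal.ofReal (∫ s in Icc 0 τ, q s) := (ofReal_integral_eq_lintegral_ofReal hqi (ae_of_all _ fun s => hq0 s)).symm

/-- **Tonelli for a tent-windowed increment.**  Let `H((t₀, x), s) ≥ 0` be measurable and bounded, with
`x ↦ H((t₀,x),s)` integrable and `∫ₓ H((t₀,·),s) ≤ b(t₀)` whenever `t₀ ∈ I`, `|s − t₀| < r²`.  If every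
window of `I` is full (`I ⊆ [r², τ − r²]`), then
`∫⁻_{t₀ ∈ I} ∫⁻_x ofReal (∫_{s ∈ [0,τ]} w(s − t₀) H((t₀,x),s) ds) ≤ ∫⁻_{t₀ ∈ I} ofReal (b t₀)`. [folklore] -/
theorem lintegral_window_increment_le {r : ℝ} (hr : 0 < r) {τ : ℝ} {H : (ℝ × T3) × ℝ → ℝ} (hH : Measurable H)
    (h0 : ∀ q, 0 ≤ H q) {B : ℝ} (hB : ∀ q, H q ≤ B) (hHx : ∀ t₀ s, Integrable (fun x : T3 => H ((t₀, x), s)) volume)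
    {b : ℝ → ℝ} {I : Set ℝ} (hImeas : MeasurableSet I) (hI : I ⊆ Icc (r ^ 2) (τ - r ^ 2))
    (hHb : ∀ t₀ ∈ I, ∀ s, |s - t₀| < r ^ 2 → ∫ x, H ((t₀, x), s) ≤ b t₀) :
    ∫⁻ t₀ in I, ∫⁻ x, ENNReal.ofReal (∫ s in Icc 0 τ, (r ^ 2)⁻¹ * max (1 - |s - t₀| / r ^ 2) 0 * H ((t₀, x), s)) ≤
      ∫⁻ t₀ in I, ENNReal.ofReal (b t₀) := by
  have hh : 0 < r ^ 2 := by positivity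
  have hw0 : ∀ a, 0 ≤ (r ^ 2)⁻¹ * max (1 - |a| / r ^ 2) 0 := fun a => (tent_nonneg_le hh a).1
  refine setLIntegral_mono' hImeas fun t₀ ht₀ => ?_
  have ht₀' := hI ht₀
  -- step 1: the `s`-integral as a Lebesgue integral
  have hstep1 : ∀ x, ENNReal.ofReal (∫ s in Icc 0 τ, (r ^ 2)⁻¹ * max (1 - |s - t₀| / r ^ 2) 0 * H ((t₀, x), s)) =
      ∫⁻ s in Icc 0 τ, ENNReal.ofReal ((r ^ 2)⁻¹ * max (1 - |s - t₀| / r ^ 2) 0 * H ((t₀, x), s)) := by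
    intro x
    have hms : Measurable fun s => H ((t₀, x), s) := (Measurable.comp hH (measurable_const.prodMk measurable_id) :)
    refine ofReal_integral_eq_lintegral_ofReal (integrableOn_tent_mul hr t₀ τ hms (B := B) fun s => ?_)
      (ae_of_all _ fun s => mul_nonneg (hw0 _) (h0 _))
    rw [abs_of_nonneg (h0 _)]; exact hB _
  simp_rw [hstep1]
  -- step 2: swap `x` and `s`
  have hm2 : Measurable fun p : T3 × ℝ => ENNReal.ofReal ((r ^ 2)⁻¹ * max (1 - |p.2 - t₀| / r ^ 2) 0 * H ((t₀, p.1), p.2)) := by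
    have ha : Measurable fun p : T3 × ℝ => (r ^ 2)⁻¹ * max (1 - |p.2 - t₀| / r ^ 2) 0 :=
      measurable_const.mul ((measurable_const.sub (((measurable_snd.sub measurable_const).abs).div_const _)).max
        measurable_const)
    have h2 : Measurable fun p : T3 × ℝ => (((t₀, p.1), p.2) : (ℝ × T3) × ℝ) :=
      (measurable_const.prodMk measurable_fst).prodMk measurable_snd
    have hb : Measurable fun p : T3 × ℝ => H ((t₀, p.1), p.2) := (Measurable.comp hH h2 :)
    exact (ha.mul hb).ennreal_ofReal
  rw [lintegral_lintegral_swap hm2.aemeasurable]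
  -- step 3: bound the space integral on the window, then the tent mass is one
  have hxm : ∀ s, Measurable fun x : T3 => ENNReal.ofReal (H ((t₀, x), s)) := by
    intro s
    have h2 : Measurable fun x : T3 => (((t₀, x), s) : (ℝ × T3) × ℝ) :=
      (measurable_const.prodMk measurable_id).prodMk measurable_const
    exact ((Measurable.comp hH h2 :)).ennreal_ofReal
  calc ∫⁻ s in Icc 0 τ, ∫⁻ x, ENNReal.ofReal ((r ^ 2)⁻¹ * max (1 - |s - t₀| / r ^ 2) 0 * H ((t₀, x), s))
      ≤ ∫⁻ s in Icc 0 τ, ENNReal.ofReal ((r ^ 2)⁻¹ * max (1 - |s - t₀| / r ^ 2) 0) * ENNReal.ofReal (b t₀) := by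
        refine lintegral_mono fun s => ?_
        calc ∫⁻ x, ENNReal.ofReal ((r ^ 2)⁻¹ * max (1 - |s - t₀| / r ^ 2) 0 * H ((t₀, x), s))
            = ∫⁻ x, ENNReal.ofReal ((r ^ 2)⁻¹ * max (1 - |s - t₀| / r ^ 2) 0) * ENNReal.ofReal (H ((t₀, x), s)) :=
              lintegral_congr fun x => ENNReal.ofReal_mul (hw0 _)
          _ = ENNReal.ofReal ((r ^ 2)⁻¹ * max (1 - |s - t₀| / r ^ 2) 0) * ∫⁻ x, ENNReal.ofReal (H ((t₀, x), s)) :=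
              lintegral_const_mul _ (hxm s)
          _ ≤ ENNReal.ofReal ((r ^ 2)⁻¹ * max (1 - |s - t₀| / r ^ 2) 0) * ENNReal.ofReal (b t₀) := by
              by_cases hws : (r ^ 2)⁻¹ * max (1 - |s - t₀| / r ^ 2) 0 = 0
              · rw [hws, ENNReal.ofReal_zero, zero_mul, zero_mul]
              · refine mul_le_mul_right ?_ _
                rw [← ofReal_integral_eq_lintegral_ofReal (hHx t₀ s) (ae_of_all _ fun x => h0 _)]
                exact ENNReal.ofReal_le_ofReal (hHb t₀ ht₀ s (abs_lt_of_tent_ne_zero hh hws))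
    _ = (∫⁻ s in Icc 0 τ, ENNReal.ofReal ((r ^ 2)⁻¹ * max (1 - |s - t₀| / r ^ 2) 0)) * ENNReal.ofReal (b t₀) :=
        lintegral_mul_const _ ((by fun_prop : Measurable fun s : ℝ => (r ^ 2)⁻¹ * max (1 - |s - t₀| / r ^ 2) 0).ennreal_ofReal)
    _ = ENNReal.ofReal (b t₀) := by rw [lintegral_tent_eq_one hr ht₀'.1 (by linarith [ht₀'.2]), one_mul]

/-! ## §2 The instances along a hard-sphere trajectory -/

/-- Along a hard-sphere trajectory `ke` is constant, hence bounded by its initial value. [folklore] -/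
theorem ke_le_init {ε : ℝ} {γ : ℝ → Phase N} (h : IsHardSphereTrajectory (Torus.geometry (Fin 3)) ε (N + 1) γ)
    (s : ℝ) : ke (γ s) ≤ ke (γ 0) := (ke_traj_eq h s 0).le

/-- The windows `I = [r², t − r²]` with `t ≤ τ` lie in `[0, τ]`. [folklore] -/
theorem windows_subset (r : ℝ) {τ t : ℝ} (htτ : t ≤ τ) : Icc (r ^ 2) (t - r ^ 2) ⊆ Icc 0 τ := by
  have hh : 0 ≤ r ^ 2 := sq_nonneg r
  exact Icc_subset_Icc hh (by linarith)

/-- The mean quadratic tail along a hard-sphere trajectory: measurable, nonnegative, bounded by `2 ke`. [folklore] -/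
theorem meanSqTail_props {ε : ℝ} {γ : ℝ → Phase N} (h : IsHardSphereTrajectory (Torus.geometry (Fin 3)) ε (N + 1) γ)
    (V : ℝ) :
    Measurable (fun s => ((N + 1 : ℕ) : ℝ)⁻¹ * ∑ i, sqTail V (γ s i).2) ∧
      (∀ s, 0 ≤ ((N + 1 : ℕ) : ℝ)⁻¹ * ∑ i, sqTail V (γ s i).2) ∧
      ∀ s, |((N + 1 : ℕ) : ℝ)⁻¹ * ∑ i, sqTail V (γ s i).2| ≤ 2 * ke (γ 0) := by
  have hγ := h.measurable_torus
  have hq0 : ∀ s, 0 ≤ ((N + 1 : ℕ) : ℝ)⁻¹ * ∑ i, sqTail V (γ s i).2 := fun s =>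
    mul_nonneg (by positivity) (Finset.sum_nonneg fun i _ => sqTail_nonneg V _)
  refine ⟨(Measurable.comp (measurable_mean_sqTail V) hγ :), hq0, fun s => ?_⟩
  rw [abs_of_nonneg (hq0 s)]
  exact (mean_sqTail_le_two_ke V _).trans (by linarith [ke_le_init h s])

/-- The cone quadratic tail field along a hard-sphere trajectory: measurable in `(s, x)`, nonnegative, bounded.
[folklore] -/
theorem tailField_props {ε : ℝ} {γ : ℝ → Phase N} (h : IsHardSphereTrajectory (Torus.geometry (Fin 3)) ε (N + 1) γ)
    {r : ℝ} (hr : 0 < r) (V : ℝ) :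
    Measurable (fun p : ℝ × T3 => MpsiC r (γ p.1) p.2 (sqTail V)) ∧
      (∀ p : ℝ × T3, 0 ≤ MpsiC r (γ p.1) p.2 (sqTail V)) ∧
      ∀ p : ℝ × T3, MpsiC r (γ p.1) p.2 (sqTail V) ≤ 3 / (Real.pi * r ^ 3) * (2 * ke (γ 0)) := by
  have hC : 0 ≤ 3 / (Real.pi * r ^ 3) := by positivity
  exact ⟨measurable_MpsiC_orbit h.measurable_torus r (measurable_sqTail V), fun p => (MpsiC_sqTail_le hr _ _ V).1,
    fun p => (MpsiC_sqTail_le hr _ _ V).2.trans (mul_le_mul_of_nonneg_left (by linarith [ke_le_init h p.1]) hC)⟩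

/-- **The windowed tail term**: `∫⁻_I ∫⁻_x ofReal (T̄) ≤ ofReal 𝒯`, `𝒯 = ∫_{[0,τ]} (N+1)⁻¹ Σ sqTail V (vᵢ(s)) ds`.
[folklore] -/
theorem lintegral_tailW_le {ε : ℝ} {γ : ℝ → Phase N} (h : IsHardSphereTrajectory (Torus.geometry (Fin 3)) ε (N + 1) γ)
    {r : ℝ} (hr : 0 < r) (hr2 : r < 1 / 2) (τ V : ℝ) (I : Set ℝ) :
    ∫⁻ t₀ in I, ∫⁻ x, ENNReal.ofReal (∫ s in Icc 0 τ, (r ^ 2)⁻¹ * max (1 - |s - t₀| / r ^ 2) 0 *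
        MpsiC r (γ s) x (sqTail V)) ≤
      ENNReal.ofReal (∫ s in Icc 0 τ, ((N + 1 : ℕ) : ℝ)⁻¹ * ∑ i, sqTail V (γ s i).2) := by
  obtain ⟨hqm, hq0, hqb⟩ := meanSqTail_props h V
  obtain ⟨hFm, hF0, hFb⟩ := tailField_props h hr V
  have hFq : ∀ s ∈ Icc 0 τ, ∫ x, MpsiC r (γ s) x (sqTail V) ≤ ((N + 1 : ℕ) : ℝ)⁻¹ * ∑ i, sqTail V (γ s i).2 :=
    fun s _ => (integral_MpsiC hr hr2 (γ s) (sqTail V)).le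
  exact lintegral_window_field_le hr τ (F := fun p => MpsiC r (γ p.1) p.2 (sqTail V)) hFm hF0 hFb hqm hq0
    (integrableOn_of_abs_le τ hqm hqb) hFq I

/-- **The instantaneous tail term**: `∫⁻_I ∫⁻_x ofReal (T(t₀, x)) ≤ ofReal 𝒯` (`I = [r², t − r²]`, `t ≤ τ`). [folklore] -/
theorem lintegral_tail0_le {ε : ℝ} {γ : ℝ → Phase N} (h : IsHardSphereTrajectory (Torus.geometry (Fin 3)) ε (N + 1) γ)
    {r : ℝ} (hr : 0 < r) (hr2 : r < 1 / 2) {τ t : ℝ} (htτ : t ≤ τ) (V : ℝ) :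
    ∫⁻ t₀ in Icc (r ^ 2) (t - r ^ 2), ∫⁻ x, ENNReal.ofReal (MpsiC r (γ t₀) x (sqTail V)) ≤
      ENNReal.ofReal (∫ s in Icc 0 τ, ((N + 1 : ℕ) : ℝ)⁻¹ * ∑ i, sqTail V (γ s i).2) := by
  obtain ⟨hqm, hq0, hqb⟩ := meanSqTail_props h V
  obtain ⟨hFm, hF0, hFb⟩ := tailField_props h hr V
  have hFq : ∀ s ∈ Icc 0 τ, ∫ x, MpsiC r (γ s) x (sqTail V) ≤ ((N + 1 : ℕ) : ℝ)⁻¹ * ∑ i, sqTail V (γ s i).2 :=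
    fun s _ => (integral_MpsiC hr hr2 (γ s) (sqTail V)).le
  exact lintegral_instant_field_le τ (F := fun p => MpsiC r (γ p.1) p.2 (sqTail V)) hFm hF0 hFb hq0
    (integrableOn_of_abs_le τ hqm hqb) hFq (windows_subset r htτ)

/-- **The windowed energy term**: `∫⁻_I ∫⁻_x ofReal (ē) ≤ ofReal (ke · τ)` (`τ ≥ 0`). [folklore] -/
theorem lintegral_kinW_le {ε : ℝ} {γ : ℝ → Phase N} (h : IsHardSphereTrajectory (Torus.geometry (Fin 3)) ε (N + 1) γ)
    {r : ℝ} (hr : 0 < r) (hr2 : r < 1 / 2) {τ : ℝ} (hτ : 0 ≤ τ) (I : Set ℝ) :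
    ∫⁻ t₀ in I, ∫⁻ x, ENNReal.ofReal (∫ s in Icc 0 τ, (r ^ 2)⁻¹ * max (1 - |s - t₀| / r ^ 2) 0 * kinC r (γ s) x) ≤
      ENNReal.ofReal (ke (γ 0) * τ) := by
  have hγ := h.measurable_torus
  have hC : 0 ≤ 3 / (Real.pi * r ^ 3) := by positivity
  have hK0 : 0 ≤ ke (γ 0) := ke_nonneg _
  have hFm : Measurable (fun p : ℝ × T3 => kinC r (γ p.1) p.2) := measurable_kinC_orbit hγ r
  have hF0 : ∀ p : ℝ × T3, 0 ≤ kinC r (γ p.1) p.2 := fun p => kinC_nonneg hr _ _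
  have hFb : ∀ p : ℝ × T3, kinC r (γ p.1) p.2 ≤ 3 / (Real.pi * r ^ 3) * ke (γ 0) := fun p =>
    (kinC_le_sup hr _ _).2.trans (mul_le_mul_of_nonneg_left (ke_le_init h p.1) hC)
  have hFq : ∀ s ∈ Icc 0 τ, ∫ x, kinC r (γ s) x ≤ ke (γ 0) := fun s _ => by
    rw [integral_kinC_eq_ke hr hr2]; exact ke_le_init h s
  have hqi : IntegrableOn (fun _ : ℝ => ke (γ 0)) (Icc 0 τ) volume :=
    integrableOn_const (by rw [Real.volume_Icc]; exact ENNReal.ofReal_ne_top)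
  have h1 := lintegral_window_field_le hr τ (F := fun p => kinC r (γ p.1) p.2) hFm hF0 hFb
    (q := fun _ => ke (γ 0)) measurable_const (fun _ => hK0) hqi hFq I
  refine h1.trans (le_of_eq ?_)
  rw [setIntegral_const, measureReal_def, Real.volume_Icc, ENNReal.toReal_ofReal (by linarith), smul_eq_mul, sub_zero,
    mul_comm]

/-- **The density increment term**: `∫⁻_I ∫⁻_x ofReal (Δρ) ≤ ofReal (8 r (½ + ke) τ)` (`0 ≤ t ≤ τ`). [folklore] -/
theorem lintegral_rhoIncrement_le {ε : ℝ} {γ : ℝ → Phase N}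
    (h : IsHardSphereTrajectory (Torus.geometry (Fin 3)) ε (N + 1) γ) {r : ℝ} (hr : 0 < r) (hr2 : r < 1 / 2)
    {τ t : ℝ} (htτ : t ≤ τ) :
    ∫⁻ t₀ in Icc (r ^ 2) (t - r ^ 2), ∫⁻ x, ENNReal.ofReal (∫ s in Icc 0 τ, (r ^ 2)⁻¹ * max (1 - |s - t₀| / r ^ 2) 0 *
        |rhoC r (γ s) x - rhoC r (γ t₀) x|) ≤
      ENNReal.ofReal (8 * r * (1 / 2 + ke (γ 0)) * τ) := by
  have hγ := h.measurable_torus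
  have hK0 : 0 ≤ ke (γ 0) := ke_nonneg _
  set b₀ : ℝ := r ^ 2 * (8 / r * (1 / 2 + ke (γ 0))) with hb₀
  have hb0 : 0 ≤ b₀ := by positivity
  set H : (ℝ × T3) × ℝ → ℝ := fun q => |rhoC r (γ q.2) q.1.2 - rhoC r (γ q.1.1) q.1.2| with hH
  have hHm : Measurable H := measurable_rhoC_increment hγ r
  have hH0 : ∀ q, 0 ≤ H q := fun q => abs_nonneg _
  have hHB : ∀ q, H q ≤ 2 * (3 / (Real.pi * r ^ 3)) := fun q => by
    simp only [hH]
    refine (abs_sub _ _).trans ?_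
    rw [abs_of_nonneg (rhoC_nonneg hr _ _), abs_of_nonneg (rhoC_nonneg hr _ _)]
    linarith [rhoC_le hr (γ q.2) q.1.2, rhoC_le hr (γ q.1.1) q.1.2]
  have hHx : ∀ t₀ s, Integrable (fun x : T3 => H ((t₀, x), s)) volume := fun t₀ s =>
    integrable_of_continuous_T3 ((continuous_rhoC r (γ s)).sub (continuous_rhoC r (γ t₀))).abs
  have hHb : ∀ t₀ ∈ Icc (r ^ 2) (t - r ^ 2), ∀ s, |s - t₀| < r ^ 2 → ∫ x, H ((t₀, x), s) ≤ b₀ := fun t₀ _ s hs =>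
    integral_abs_rhoC_window_le h hr hr2 hs.le 0
  have h1 := lintegral_window_increment_le hr (τ := τ) hHm hH0 hHB hHx (b := fun _ => b₀) measurableSet_Icc
    (Icc_subset_Icc le_rfl (by linarith)) hHb
  refine h1.trans ?_
  rw [setLIntegral_const, Real.volume_Icc, ← ENNReal.ofReal_mul hb0]
  refine ENNReal.ofReal_le_ofReal ?_
  have hle : t - r ^ 2 - r ^ 2 ≤ τ := by nlinarith
  have er : r ^ 2 * (8 / r) = 8 * r := by rw [sq, mul_assoc, mul_div_cancel₀ _ hr.ne']; ring
  calc b₀ * (t - r ^ 2 - r ^ 2) ≤ b₀ * τ := mul_le_mul_of_nonneg_left hle hb0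
    _ = r ^ 2 * (8 / r) * (1 / 2 + ke (γ 0)) * τ := by simp only [hb₀]; ring
    _ = 8 * r * (1 / 2 + ke (γ 0)) * τ := by rw [er]

/-- **The momentum increment term**: `∫⁻_I ∫⁻_x ofReal (Δm) ≤ ofReal (16 ke r τ + (N+1)⁻¹ 8 ε r 𝒮(0, τ])`
(`0 ≤ t ≤ τ`, `ε ≥ 0`). [folklore] -/
theorem lintegral_momIncrement_le {ε : ℝ} (hε : 0 ≤ ε) {γ : ℝ → Phase N}
    (h : IsHardSphereTrajectory (Torus.geometry (Fin 3)) ε (N + 1) γ) {r : ℝ} (hr : 0 < r) (hr2 : r < 1 / 2)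
    {τ t : ℝ} (ht : 0 ≤ t) (htτ : t ≤ τ) :
    ∫⁻ t₀ in Icc (r ^ 2) (t - r ^ 2), ∫⁻ x, ENNReal.ofReal (∫ s in Icc 0 τ, (r ^ 2)⁻¹ * max (1 - |s - t₀| / r ^ 2) 0 *
        ‖momC r (γ s) x - momC r (γ t₀) x‖) ≤
      ENNReal.ofReal (16 * ke (γ 0) * r * τ + ((N + 1 : ℕ) : ℝ)⁻¹ * (8 * ε * r) *
        collisionalTransferFunctional (Torus.geometry (Fin 3)) ε (fun i _ pre post => ‖(post i).2 - (pre i).2‖) γ 0 τ) := by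
  have hγ := h.measurable_torus
  have hK0 : 0 ≤ ke (γ 0) := ke_nonneg _
  have hC : 0 ≤ 3 / (Real.pi * r ^ 3) := by positivity
  have hg : ∀ (i j : Fin (N + 1)) (pre post : Phase N), 0 ≤ (fun i (_ : Fin (N + 1)) (pre post : Phase N) =>
      ‖(post i).2 - (pre i).2‖) i j pre post := fun _ _ _ _ => norm_nonneg _
  set S : ℝ → ℝ → ℝ := fun a b => collisionalTransferFunctional (Torus.geometry (Fin 3)) ε
    (fun i _ pre post => ‖(post i).2 - (pre i).2‖) γ a b with hS
  have hS0 : ∀ a b, 0 ≤ S a b := fun a b => ctf_nonneg hg a b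
  set c₁ : ℝ := r ^ 2 * (8 / r * (2 * ke (γ 0))) with hc₁
  set c₂ : ℝ := ((N + 1 : ℕ) : ℝ)⁻¹ * (8 * ε / r) * 2⁻¹ with hc₂
  have hc₁0 : 0 ≤ c₁ := by positivity
  have hc₂0 : 0 ≤ c₂ := mul_nonneg (mul_nonneg (by positivity) (div_nonneg (by positivity) hr.le)) (by norm_num)
  set H : (ℝ × T3) × ℝ → ℝ := fun q => ‖momC r (γ q.2) q.1.2 - momC r (γ q.1.1) q.1.2‖ with hH
  have hHm : Measurable H := measurable_momC_increment hγ r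
  have hH0 : ∀ q, 0 ≤ H q := fun q => norm_nonneg _
  have hHB : ∀ q, H q ≤ 2 * (3 / (Real.pi * r ^ 3) * (1 / 2 + ke (γ 0))) := fun q => by
    simp only [hH]
    refine (norm_sub_le _ _).trans ?_
    have h1 := norm_momC_le hr (γ q.2) q.1.2
    have h2 := norm_momC_le hr (γ q.1.1) q.1.2
    nlinarith [ke_le_init h q.2, ke_le_init h q.1.1, hC]
  have hHx : ∀ t₀ s, Integrable (fun x : T3 => H ((t₀, x), s)) volume := fun t₀ s =>
    integrable_of_continuous_T3 ((continuous_momC r (γ s)).sub (continuous_momC r (γ t₀))).norm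
  set b : ℝ → ℝ := fun t₀ => c₁ + c₂ * S (t₀ - r ^ 2) (t₀ + r ^ 2) with hb
  have hHb : ∀ t₀ ∈ Icc (r ^ 2) (t - r ^ 2), ∀ s, |s - t₀| < r ^ 2 → ∫ x, H ((t₀, x), s) ≤ b t₀ := by
    intro t₀ _ s hs
    refine (integral_norm_momC_window_le hε h hr hr2 hs.le 0).trans (le_of_eq ?_)
    simp only [hb, hc₁, hc₂, hS]
    ring
  have h1 := lintegral_window_increment_le hr (τ := τ) hHm hH0 hHB hHx (b := b) measurableSet_Icc
    (Icc_subset_Icc le_rfl (by linarith)) hHb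
  refine h1.trans ?_
  -- integrate the window bound over the centres
  have hsplit : ∀ t₀, ENNReal.ofReal (b t₀) = ENNReal.ofReal c₁ + ENNReal.ofReal c₂ * ENNReal.ofReal (S (t₀ - r ^ 2) (t₀ + r ^ 2)) :=
    fun t₀ => by
    simp only [hb]
    rw [ENNReal.ofReal_add hc₁0 (mul_nonneg hc₂0 (hS0 _ _)), ENNReal.ofReal_mul hc₂0]
  simp_rw [hsplit]
  rw [lintegral_add_left measurable_const, setLIntegral_const, lintegral_const_mul' _ _ ENNReal.ofReal_ne_top]
  have hW := lintegral_ctf_window_le h hg (r ^ 2) (r ^ 2) (t - r ^ 2)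
  rw [sub_self, sub_add_cancel] at hW
  have hSt : S 0 t ≤ S 0 τ := ctf_mono_right h hg ht htτ
  have hvol : volume (Icc (r ^ 2) (t - r ^ 2)) ≤ ENNReal.ofReal τ := by
    rw [Real.volume_Icc]; exact ENNReal.ofReal_le_ofReal (by nlinarith)
  have er : r ^ 2 * (8 / r) = 8 * r := by rw [sq, mul_assoc, mul_div_cancel₀ _ hr.ne']; ring
  have er2 : 8 * ε / r * r ^ 2 = 8 * ε * r := by rw [sq, ← mul_assoc, div_mul_cancel₀ _ hr.ne']
  calc ENNReal.ofReal c₁ * volume (Icc (r ^ 2) (t - r ^ 2)) +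
        ENNReal.ofReal c₂ * ∫⁻ t₀ in Icc (r ^ 2) (t - r ^ 2), ENNReal.ofReal (S (t₀ - r ^ 2) (t₀ + r ^ 2))
      ≤ ENNReal.ofReal c₁ * ENNReal.ofReal τ + ENNReal.ofReal c₂ * ENNReal.ofReal (2 * r ^ 2 * S 0 t) :=
        add_le_add (mul_le_mul_right hvol _) (mul_le_mul_right hW _)
    _ = ENNReal.ofReal (c₁ * τ + c₂ * (2 * r ^ 2 * S 0 t)) := by
        have hτ0 : 0 ≤ τ := ht.trans htτ
        rw [← ENNReal.ofReal_mul hc₁0, ← ENNReal.ofReal_mul hc₂0,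
          ← ENNReal.ofReal_add (mul_nonneg hc₁0 hτ0) (mul_nonneg hc₂0 (mul_nonneg (by positivity) (hS0 0 t)))]
    _ ≤ _ := by
        refine ENNReal.ofReal_le_ofReal ?_
        have e1 : c₁ * τ = 16 * ke (γ 0) * r * τ := by
          calc c₁ * τ = r ^ 2 * (8 / r) * (2 * ke (γ 0)) * τ := by simp only [hc₁]; ring
            _ = _ := by rw [er]; ring
        have e2 : c₂ * (2 * r ^ 2 * S 0 t) = ((N + 1 : ℕ) : ℝ)⁻¹ * (8 * ε * r) * S 0 t := by
          calc c₂ * (2 * r ^ 2 * S 0 t) = ((N + 1 : ℕ) : ℝ)⁻¹ * (8 * ε / r * r ^ 2) * (2⁻¹ * 2) * S 0 t := by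
                simp only [hc₂]; ring
            _ = _ := by rw [er2]; norm_num
        rw [e1, e2]
        refine add_le_add le_rfl (mul_le_mul_of_nonneg_left hSt ?_)
        exact mul_nonneg (by positivity) (by positivity)

/-- **Registered sub-goal `stub_stressIsotropyOfWindowCovarianceI` (helper I of
`stub_stressIsotropyOfWindowCovariance`): full tent windows have Lebesgue mass one.** [folklore] -/
theorem stub_stressIsotropyOfWindowCovarianceI : ∀ {r : ℝ}, 0 < r → ∀ {τ t₀ : ℝ}, r ^ 2 ≤ t₀ → t₀ + r ^ 2 ≤ τ → ∫⁻ s in Set.Icc 0 τ, ENNReal.ofReal ((r ^ 2)⁻¹ * max (1 - |s - t₀| / r ^ 2) 0) = 1 :=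
  fun hr _ _ h1 h2 => lintegral_tent_eq_one hr h1 h2

end Summit.AtomisticToContinuum.HydrodynamicLimit.Theorems.ParityBandClosureWindowToCone

end
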